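import Literature.AlgebraicGeometry.ShimuraVarieties.UnitaryShimuraCanonicalModel
import Literature.AlgebraicGeometry.Motives.JacobianGaloisDescent
import Literature.AlgebraicGeometry.Motives.BaseChangePointsProofs
import Literature.NumberTheory.NumberFields.NormOneTorusRealApproximation
import Literature.NumberTheory.Automorphic.UnitaryGroupFrameHermitian
import HarnessLib

/-!
# Complex points of the complex fibre of Deligne's canonical model and the Galois automorphisms `1 × Spec σ`

Topic `AlgebraicGeometry/ShimuraVarieties`, namespace `…ShimuraVarieties.UnitaryCanonicalModel`. THEOREMS ONLY (no
definition, no named fact, no `sorry`). Bookkeeping for the descent of Hecke translates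
(`UnitaryShimuraHeckeDescent`, [Milne2005ShimuraVarieties] Thm. 13.6 by its printed proof): for an `L`-scheme `X`,
`τ : L →+* ℂ` and a complex point `P ∈ X(ℂ)` along `τ` (the tree's `ComplexPoints X` under `τ.toAlgebra`), the
point `(P, 1) : Spec ℂ → X ×_L Spec ℂ` of the complex fibre written as an explicit `pullback.lift` in the
fibre-product spelling of `Motives/JacobianGaloisDescent` (`GaloisDescent.bc`, `gal`):

* `toSpecHom_comp_hom_eq`, `lift_eq_baseChangeEquiv_left` — `(P, 1)` is well defined and IS the tree's
  `AlgPoints.baseChangeEquiv τ X P`; `eq_of_lift_eq` — it determines `P`;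
* `toSpecHom_smul`, **`lift_comp_gal`** — the Galois automorphism `gal σ = 1 × Spec σ⁻¹` (`σ ∈ Aut(ℂ/τL)`) moves
  `(P, 1)` to `(σ • P, 1)` up to `Spec σ⁻¹` on the source: «the actions of `Aut(Ω/k)` on `V(Ω)`» of
  [Milne2005ShimuraVarieties] Prop. 13.1 p. 117, for the tree's LEFT action `σ • P = Spec σ ≫ P`;
* `frame_mulVec_lift_mem_negCone`, **`exists_mem_negCone_embedding`**, `hermForm_self_ne_zero_of_mem_negCone` — a
  NEGATIVE `L`-RATIONAL LINE for `H` at `τ` exists (density of `τ(L)` in `ℂ`, `L` CM hence totally complex,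
  `NumberFields.denseRange_of_isTotallyComplex`; the negative cone is open and contains the frame vectors of ball
  points) and is anisotropic — the input of the diagonal special point of [Milne2005ShimuraVarieties] Def. 12.5 /
  Lemma 13.3 («There exists a special point in `X`») for the record `UnitaryShimuraCanonicalModel`;
* `transpose_map_complexConj_eq` — the two spellings of hermitian-ness in the tree.

## References
* [Milne2005ShimuraVarieties] J. S. Milne, *Introduction to Shimura varieties* (2005; held rev. 2017
  `paper:url-b0e8e4ca1c12`), §12 Def. 12.5 p. 113, §13 Prop. 13.1 and Lemma 13.3 p. 117.
-/

set_option autoImplicit false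

noncomputable section

open Function MulAction Topology NumberField IsDedekindDomain CategoryTheory CategoryTheory.Limits Matrix
  AlgebraicGeometry Cardinal
open scoped Matrix ComplexOrder
open Literature.AlgebraicGeometry.Motives
open Literature.NumberTheory.Automorphic Literature.NumberTheory.Automorphic.UnitaryGroup
open Literature.NumberTheory.Automorphic.Liu2021.AppendixC (C5.OpenCompactSubgroup C5.SmallLevel)
open Literature.Geometry.ComplexHyperbolic Literature.Geometry.ComplexHyperbolic.BallModel
open Literature.NumberTheory.Automorphic.ShimuraDissection

namespace Literature.AlgebraicGeometry.ShimuraVarieties.UnitaryCanonicalModel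

variable {L : Type} [Field L] [NumberField L] [IsCMField L] {H : Matrix (Fin 3) (Fin 3) L}
  {τ : L →+* ℂ} {T : GL (Fin 3) ℂ} {hT : formCongr (starRingEnd ℂ) T (H.map τ) = BallModel.J}
  {K₀ : C5.OpenCompactSubgroup ↥(finAdelic (↥(maximalRealSubfield L)) L (IsCMField.complexConj L) 3 H)}

/-! ### §1. Complex points of the complex fibre, and the Galois automorphisms `gal σ` -/

omit [NumberField L] [IsCMField L] in
/-- The structure equation of a complex point `P ∈ X(ℂ)` (along `τ`): `P ≫ (X → Spec L) = Spec ℂ → Spec L`,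
so that `(P, 1)` is a point of the complex fibre `X ×_L Spec ℂ`. [cite: Milne2005ShimuraVarieties, §13 Prop. 13.1
p. 117 («the actions of Aut(Ω/k) on V(Ω)»)] -/
theorem toSpecHom_comp_hom_eq (X : SchemeOver L) (P : letI : Algebra L ℂ := τ.toAlgebra; ComplexPoints X) :
    letI : Algebra L ℂ := τ.toAlgebra
    P.toSpecHom ≫ X.hom = 𝟙 (Spec (.of ℂ)) ≫ AbelianVariety.bcSpec L ℂ := by
  letI : Algebra L ℂ := τ.toAlgebra
  rw [Category.id_comp]
  exact Over.w P

omit [NumberField L] [IsCMField L] in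
/-- The point `(P, 1) : Spec ℂ → X ×_L Spec ℂ` of the complex fibre attached to `P ∈ X(ℂ)` IS the tree's
`AlgPoints.baseChangeEquiv τ X P` (universal property of the fibre product, read on the underlying morphism).
[cite: Milne2005ShimuraVarieties, §13 Prop. 13.1 p. 117] -/
theorem lift_eq_baseChangeEquiv_left (X : SchemeOver L) (P : letI : Algebra L ℂ := τ.toAlgebra; ComplexPoints X) :
    letI : Algebra L ℂ := τ.toAlgebra
    pullback.lift P.toSpecHom (𝟙 (Spec (.of ℂ))) (toSpecHom_comp_hom_eq (τ := τ) X P) =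
      (AlgPoints.baseChangeEquiv τ X P).left := by
  letI : Algebra L ℂ := τ.toAlgebra
  apply pullback.hom_ext
  · rw [pullback.lift_fst]
    exact (AlgPoints.baseChangeEquiv_apply_left_comp_fst τ X P).symm
  · rw [pullback.lift_snd]
    have h := AlgPoints.baseChangeEquiv_apply_left_comp_snd τ X P
    rw [Algebra.algebraMap_self, CommRingCat.ofHom_id] at h
    erw [Spec.map_id] at h
    exact h.symm

omit [NumberField L] [IsCMField L] in
/-- The Galois translate of a complex point on underlying morphisms: `(σ • P) = Spec σ ≫ P` (the tree's LEFT
action, `AlgPoints.smul_left`). [cite: Milne2005ShimuraVarieties, §13 Prop. 13.1 p. 117] -/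
theorem toSpecHom_smul (X : SchemeOver L) (σ : letI : Algebra L ℂ := τ.toAlgebra; ℂ ≃ₐ[L] ℂ)
    (P : letI : Algebra L ℂ := τ.toAlgebra; ComplexPoints X) :
    letI : Algebra L ℂ := τ.toAlgebra
    (σ • P).toSpecHom = AbelianVariety.specAut ℂ σ ≫ P.toSpecHom := by
  letI : Algebra L ℂ := τ.toAlgebra
  exact AlgPoints.smul_left σ P

omit [NumberField L] [IsCMField L] in
/-- **`gal σ` acts on complex points as `P ↦ σ • P`**: `(P, 1) ≫ (1 × Spec σ⁻¹) = Spec σ⁻¹ ≫ (σ • P, 1)` as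
morphisms `Spec ℂ → X ×_L Spec ℂ`, for `σ ∈ Aut(ℂ/τL)` and the tree's LEFT action `σ • P = Spec σ ≫ P`.
[cite: Milne2005ShimuraVarieties, §13 Prop. 13.1 p. 117 («the actions of Aut(Ω/k) on V(Ω)»)] -/
theorem lift_comp_gal (X : SchemeOver L) (σ : letI : Algebra L ℂ := τ.toAlgebra; ℂ ≃ₐ[L] ℂ)
    (P : letI : Algebra L ℂ := τ.toAlgebra; ComplexPoints X) :
    letI : Algebra L ℂ := τ.toAlgebra
    pullback.lift P.toSpecHom (𝟙 (Spec (.of ℂ))) (toSpecHom_comp_hom_eq (τ := τ) X P) ≫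
        GaloisDescent.gal ℂ X σ =
      AbelianVariety.specAut ℂ σ⁻¹ ≫
        pullback.lift (σ • P).toSpecHom (𝟙 (Spec (.of ℂ))) (toSpecHom_comp_hom_eq (τ := τ) X (σ • P)) := by
  letI : Algebra L ℂ := τ.toAlgebra
  apply pullback.hom_ext
  · rw [Category.assoc, GaloisDescent.gal_fst, pullback.lift_fst, Category.assoc, pullback.lift_fst,
      toSpecHom_smul, ← Category.assoc, AbelianVariety.specAut_symm_comp_specAut, Category.id_comp]
  · rw [Category.assoc, GaloisDescent.gal_snd, pullback.lift_snd_assoc, Category.assoc, pullback.lift_snd,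
      Category.id_comp, Category.comp_id]

omit [NumberField L] [IsCMField L] in
/-- Two complex points with the same attached point of the complex fibre are equal (the first projection recovers
`P`). [cite: Milne2005ShimuraVarieties, §13 Prop. 13.1 p. 117] -/
theorem eq_of_lift_eq (X : SchemeOver L) (P Q : letI : Algebra L ℂ := τ.toAlgebra; ComplexPoints X)
    (h : letI : Algebra L ℂ := τ.toAlgebra
      pullback.lift P.toSpecHom (𝟙 (Spec (.of ℂ))) (toSpecHom_comp_hom_eq (τ := τ) X P) =
        pullback.lift Q.toSpecHom (𝟙 (Spec (.of ℂ))) (toSpecHom_comp_hom_eq (τ := τ) X Q)) :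
    P = Q := by
  letI : Algebra L ℂ := τ.toAlgebra
  apply Over.OverMorphism.ext
  have h' := congrArg (· ≫ pullback.fst X.hom (AbelianVariety.bcSpec L ℂ)) h
  simp only [pullback.lift_fst] at h'
  exact h'

/-! ### §2. A negative `L`-line (input of the diagonal special point) -/

omit [NumberField L] [IsCMField L] in
/-- In the frame `T` (`Tᴴ H^τ T = J`) the hermitian square of `T w` is `Q(w)` (as in
`UnitaryShimuraCanonicalModelNonVacuity`). [cite: Milne2005ShimuraVarieties, Def. 12.5 p. 113] -/
private theorem hermForm_frame_apply' (hT : formCongr (starRingEnd ℂ) T (H.map τ) = BallModel.J)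
    (w : Fin 3 → ℂ) :
    hermForm (starRingEnd ℂ) (H.map τ) ((T : Matrix (Fin 3) (Fin 3) ℂ) *ᵥ w)
        ((T : Matrix (Fin 3) (Fin 3) ℂ) *ᵥ w) = ((Q w : ℝ) : ℂ) := by
  rw [hermForm_starRingEnd, ← form_eq_Q, ← hT, star_mulVec, ← dotProduct_mulVec, mulVec_mulVec,
    mulVec_mulVec]
  rfl

omit [NumberField L] [IsCMField L] in
/-- The frame vector `T·(x, 1)` of a ball point is a negative vector of `H^τ` (`Tᴴ H^τ T = J` and
`Q(x,1) < 0`). [cite: Milne2005ShimuraVarieties, Def. 12.5 p. 113] -/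
theorem frame_mulVec_lift_mem_negCone (hT : formCongr (starRingEnd ℂ) T (H.map τ) = BallModel.J)
    (x : Ball) : (T : Matrix (Fin 3) (Fin 3) ℂ) *ᵥ BallModel.lift x ∈ negCone (H.map τ) := by
  rw [mem_negCone_iff, ← hermForm_starRingEnd, hermForm_frame_apply' hT, Complex.ofReal_re]
  exact Q_lift x

/-- **A negative `L`-rational line exists**: since `τ(L)` is dense in `ℂ` (`L` is CM, hence totally complex:
`NumberFields.denseRange_of_isTotallyComplex`) and the negative cone of `H^τ` is open and non-empty, some
`v₃ ∈ L³` has `τ(v₃)` negative — the diagonal torus / special point of [Milne2005ShimuraVarieties] Def. 12.5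
exists for the record's `H`. [cite: Milne2005ShimuraVarieties, Lemma 13.3 p. 117 and Def. 12.5 p. 113] -/
theorem exists_mem_negCone_embedding (hT : formCongr (starRingEnd ℂ) T (H.map τ) = BallModel.J) :
    ∃ v₃ : Fin 3 → L, (fun i => τ (v₃ i)) ∈ negCone (H.map τ) := by
  have hd : DenseRange (fun v : Fin 3 → L => fun i => τ (v i)) := by
    have h1 : DenseRange (τ : L → ℂ) := Literature.NumberTheory.NumberFields.denseRange_of_isTotallyComplex L τ
    exact DenseRange.piMap fun _ : Fin 3 => h1
  obtain ⟨v₃, hv⟩ := hd.exists_mem_open (isOpen_negCone (H.map τ))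
    ⟨_, frame_mulVec_lift_mem_negCone hT BallModel.x₀⟩
  exact ⟨v₃, hv⟩

/-- A negative `L`-vector at `τ` is anisotropic: `⟪v₃, v₃⟫_H ≠ 0` (its image under `τ` is the negative real
number `⟪τv₃, τv₃⟫_{H^τ}`). [cite: Milne2005ShimuraVarieties, Def. 12.5 p. 113] -/
theorem hermForm_self_ne_zero_of_mem_negCone {v₃ : Fin 3 → L} (hv : (fun i => τ (v₃ i)) ∈ negCone (H.map τ)) :
    hermForm (cmConjRingHom L) H v₃ v₃ ≠ 0 := by
  intro h0
  have h := map_hermForm (σ := cmConjRingHom L) τ (embedding_cmConjRingHom L τ) H v₃ v₃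
  rw [h0, map_zero] at h
  rw [mem_negCone_iff, ← hermForm_starRingEnd] at hv
  have : (hermForm (starRingEnd ℂ) (H.map τ) (fun i => τ (v₃ i)) fun i => τ (v₃ i)) = 0 := h.symm
  rw [this, Complex.zero_re] at hv
  exact lt_irrefl _ hv

/-! ### §3. The two spellings of hermitian-ness -/

/-- `ᵗ(H^c) = H` from `c(Hᵢⱼ) = Hⱼᵢ`: the hermitian-ness hypothesis of `HeckeOrbitDensity` from that of the record's §7
(both follow from the frame, `cmConjRingHom_apply_eq_of_formCongr_eq_J`). [cite: Milne2005ShimuraVarieties, §13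
Lemma 13.5 p. 118 (hypothesis «`G` connected», here: `H` hermitian)] -/
theorem transpose_map_complexConj_eq (hH : ∀ i j, cmConjRingHom L (H i j) = H j i) :
    (H.map (IsCMField.complexConj L))ᵀ = H := by
  ext i j
  rw [Matrix.transpose_apply, Matrix.map_apply, ← cmConjRingHom_apply]
  exact hH j i

end Literature.AlgebraicGeometry.ShimuraVarieties.UnitaryCanonicalModel

end
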